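import Literature.MathematicalPhysics.QuantumFieldTheory.Balaban1983to89.B12Eq441SymbolExpansion
import Literature.MathematicalPhysics.QuantumFieldTheory.Balaban1983to89.B5Symbol166Strip
import Literature.MathematicalPhysics.QuantumFieldTheory.Balaban1983to89.Beta.AliasRatioDerivs

/-!
# B12 (4.43)/(4.45) pp. 291–292, LITERAL: the symbol `Δ̃_{j,μν}(p′)` of Bałaban's `Δ_j` ([B5] (1.66)) is
# real-analytic at `p′ = 0`, `(∂/∂p′_κ)Δ̃_{j,μν}(0) = 0` and `−(∂²/∂p′_κ∂p′_λ)Δ̃_{j,μν}(0) = δ_{μκ}δ_{νλ} + δ_{μλ}δ_{νκ} − 2δ_{μν}δ_{κλ}`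

statement-level skeleton of published theorems with citation tags; proofs where landed; nothing here is a
claim about the Yang–Mills mass gap.

Sources: T. Bałaban, *Renormalization group approach to lattice gauge field theories. I*, Commun. Math.
Phys. **109** (1987) 249–301 (`Balaban1987RG1`, "B12"), p. 291 [PDF 43] and p. 292 [PDF 44] (held:
`lit read paper:balaban1987-cmp109-rg-i-small-field --pages 43-44`); T. Bałaban, *Propagators and
renormalization transformations for lattice gauge theories. I*, Commun. Math. Phys. **95** (1984) 17–40
(`Balaban1984PropagatorsI`, "B5" = B12's reference [10]), (1.62) p. 28, (1.66) p. 29.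
PDF held: yes (both).  Unit `lit-balaban` (HOME `run/shared/lean/pub/lit-balaban/`), Phase-2 proof seat p10
(gen 7); WHAT IS REPRODUCED = SKELETON row `B12.Eq4.42-4.45`, members (4.43) and (4.45), for the typed symbol
`B12Eq441SymbolExpansion.symbDeltaJ` (row `B12.Eq4.41`).

## What the paper prints (verbatim, B12 pp. 291–292)

p. 291: «In the second term we have the expression
  β_j(g_{j−1}) Σ_y Δ_{j,μν}(x − y)(y_κ − x_κ)(y_λ − x_λ) = −β_j(g_{j−1})((∂²/∂p′_κ∂p′_λ)Δ̃_{j,μν})(0)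
  = β_j(g_{j−1})(δ_{μκ}δ_{νλ} + δ_{μλ}δ_{νκ} − 2δ_{μν}δ_{κλ}).   (4.43)»
p. 292: «In the third term we have the expression
  β_j(g_{j−1}) Σ_y Δ_{k,μν}(x − y)(y_κ − x_κ) = β_j(g_{j−1})((1/i)(∂/∂p′_κ)Δ̃_{j,μν})(0) = 0,   (4.45)
hence this term vanishes.»  (sic «Δ_{k,μν}»; read `Δ_{j,μν}`.)
Here `Δ̃_{j,μν}(p′)` is «the function Δ_{j,μν}(x − y) in the momentum representation of (1.66)» [10] (p. 291,
before (4.41)) — in the tree: `B12Eq441SymbolExpansion.symbDeltaJ n p′ μ ν`, `n = L^j` (row B12.Eq4.41,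
`formDk_eq_symb`: it IS the momentum representation of the typed (1.66) form `B5Bounds167Lattice.formDk`).

## What this module proves (kernel-checked; every `n = L^j ≥ 1`, every `d`, all `μ ν κ λ`)

The printed displays (4.43)/(4.45) take literal first and second `p′`-derivatives of `Δ̃_j` at `p′ = 0`.  My
gen-6 file certified them in PEANO form only (`symbDeltaJ_taylor`: `Δ̃_{j,μν}(p′) = |p′|²δ_{μν} − p′_μp′_ν + O(‖p′‖³)`)
and recorded as NOT typed «the literal second p′-derivatives of Δ̃_j at 0 (its C² regularity)».  This file closes that:
* §1–§2 `analyticAt_W166_ofReal`, `symbC`, `symbC_ofReal`: the entries of `Δ̃_j` are restrictions to real momenta of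
  functions HOLOMORPHIC near the real Brillouin zone — polynomials in the tree's zero-free holomorphic normal form
  `B5Symbol166.W166` of the (1.66) integrand (unit `b2b-balaban-b05`) and the entire factors `e^{∓ip_a} − 1`
  (`B5Symbol166Strip.expFacNeg/expFacPos`); the diagonal weight `w_{νν}` (not continued by `W166`) CANCELS in
  `Δ̃_{j,νν}`, and at `p′ = 0` both sides vanish although the typed weight carries a junk value there.
* §3 **`analyticAt_symbDeltaJ`**: `p′ ↦ Δ̃_{j,μν}(p′)` is REAL-ANALYTIC at every point of the open zone `|p′_κ| < π`
  (in particular at `0`), hence `C^∞` there (`contDiffAt_symbDeltaJ`) — the regularity (4.43)/(4.45) presuppose.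
* §4 **(4.45) literal**: `hasFDerivAt_symbDeltaJ_zero` — the Fréchet derivative of `Δ̃_{j,μν}` at `0` is `0`
  (from the gen-6 bound `|Δ̃_{j,μν}(p′)| ≤ C(d)‖p′‖²`); `fderiv_symbDeltaJ_zero`; componentwise
  `pderiv_symbDeltaJ_zero`: `(∂/∂p′_κ)Δ̃_{j,μν}(0) = 0` for every `κ`, and along coordinate lines
  `hasDerivAt_symbDeltaJ_line_zero`.
* §5 **(4.43) literal** (`hess n μ ν := fderiv (fderiv Δ̃_{j,μν}) 0`, the Hessian at `0`): `hess_apply_self`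
  (`D²Δ̃_{j,μν}(0)(w,w) = 2(|w|²δ_{μν} − w_μw_ν)` for every `w`, by the second-order Taylor expansion along rays —
  Mathlib's `Convex.taylor_approx_two_segment` — against the gen-6 Peano form, then 2-homogeneity), `hess_symm`
  (Schwarz), `hess_eq_polar` (polarization), and **`hess_eDir`**:
  `(∂²/∂p′_κ∂p′_λ)Δ̃_{j,μν}(0) = D²Δ̃_{j,μν}(0)(e_κ,e_λ) = −(δ_{μκ}δ_{νλ} + δ_{μλ}δ_{νκ} − 2δ_{μν}δ_{κλ})`, i.e.
  **`neg_hess_eDir`** = the printed second «=» of (4.43) (with the tree's Kronecker symbol `B12Marginal444.kd`),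
  uniformly in `j` (no `j`-dependence at all); the same in `iteratedFDeriv ℝ 2` form
  (`iteratedFDeriv_two_symbDeltaJ_eDir`) and as an iterated partial derivative along coordinate lines
  (`hasDerivAt_pderiv_symbDeltaJ_line_zero`: `t ↦ ∂_λΔ̃_{j,μν}(te_κ)` has the printed derivative at `t = 0`);
  `hess_eDir_eq_pderiv_transverse`: it IS the `(κ,λ)` second partial derivative of the tree's transverse polynomial
  `B12Marginal444.transverse μ ν` (`B12Marginal444.neg_hessian_transverse`) — so the Peano datum of gen 6
  (`symbDeltaJ_sub_aeval_transverse_le`) is the literal Hessian, and `B12Marginal444.block2_of_moments443` /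
  `block3_eq_zero_of_moments445` apply with these derivatives once the lattice moments are identified with them.

## What is NOT claimed

(1) The FIRST «=» of (4.43)/(4.45) — the lattice-moment identities `Σ_y Δ_{j,μν}(x−y)(y−x)_κ(y−x)_λ =
−(∂_κ∂_λΔ̃_{j,μν})(0)`, `Σ_y Δ_{j,μν}(x−y)(y−x)_κ = ((1/i)∂_κΔ̃_{j,μν})(0)` (Fourier bookkeeping for the `ℤ^d`
kernel of `Δ_j`, whose exponential decay is the tree's `B5Kernel166Decay`) — is not typed here.  (2) As in
`B5Bounds167Lattice` / `B12Eq441SymbolExpansion`: `Δ̃_j` is the symbol OF THE PRINTED FORMULA (1.66) [10]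
(`U = 1`, `m² = 0`); the identity (1.65) = (1.66) is row B5.Eq1.66's business.  (3) Analyticity is proved on the open
zone `|p′_κ| < π` only (periodicity across the faces is `B5Symbol166Strip.W166_tr`, not needed here).  Nothing here
is progress on a summit; value = kernel certificate that the derivatives printed in (4.43)/(4.45) exist and have the
printed values, for the typed `Δ_j`, uniformly in the scale.
-/

noncomputable section

namespace Literature.MathematicalPhysics.QuantumFieldTheory.Balaban1983to89.B12Eq443SymbolHessian

open scoped BigOperators ComplexConjugate Topology
open Finset Complex Filter Asymptotics
open Literature.MathematicalPhysics.QuantumFieldTheory.Balaban1983to89.B4Strip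
open Literature.MathematicalPhysics.QuantumFieldTheory.Balaban1983to89.B4StripCauchy
open Literature.MathematicalPhysics.QuantumFieldTheory.Balaban1983to89.B5Prop11Fiber
open Literature.MathematicalPhysics.QuantumFieldTheory.Balaban1983to89.B5Bounds167Lattice
open Literature.MathematicalPhysics.QuantumFieldTheory.Balaban1983to89.B5Strip145Analytic
open Literature.MathematicalPhysics.QuantumFieldTheory.Balaban1983to89.B5Symbol166
open Literature.MathematicalPhysics.QuantumFieldTheory.Balaban1983to89.B5Symbol166Strip
open Literature.MathematicalPhysics.QuantumFieldTheory.Balaban1983to89.B12Eq441SymbolExpansion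
open Literature.MathematicalPhysics.QuantumFieldTheory.Balaban1983to89.Beta.AliasRatioDerivs
  (analyticAt_eval analyticAt_uFactor_zero analyticAt_uFactor_coord analyticAt_U analyticAt_DeltaXi
    analyticAt_DeltaXi_shift)

variable {d : ℕ}

/-! ## §1. Holomorphy (analyticity) of the leaves of the (1.66) normal form at the points of the fat region -/

/-- `S₁(z) = 2 − 2cos z` is entire. [folklore] -/
private theorem analyticAt_S1 (z : ℂ) : AnalyticAt ℂ S1 z := differentiable_S1.analyticAt z

/- The leaves `u_n(j;·)`, `U_k`, `Δ^ξ`, the coordinate projections: `Beta.AliasRatioDerivs` (β sub-cell of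
`pub-balaban`, row an1) — `analyticAt_uFactor_zero`, `analyticAt_uFactor_coord`, `analyticAt_U`, `analyticAt_DeltaXi`,
`analyticAt_DeltaXi_shift`, `analyticAt_eval`, reused BY NAME. -/

/-- `c_λ` (the `l = 0` term of `Δφ_λ`, (1.62)) is holomorphic on `F_r`. [cite: Balaban1984PropagatorsI, (1.62) p.28] -/
theorem analyticAt_cfac (n : ℕ) [NeZero n] {r : ℝ} (hr : r ≤ 1 / 4) {q : Fin d → ℂ} (hq : q ∈ Fat d r)
    (lam : Fin d) : AnalyticAt ℂ (fun p : Fin d → ℂ => cfac n lam p) q := by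
  have hn : 1 ≤ n := Nat.one_le_iff_ne_zero.mpr (NeZero.ne n)
  have hπ := Real.pi_gt_three
  unfold cfac
  refine (analyticAt_U n hr hq _).fun_mul ?_
  have hF : AnalyticAt ℂ (uFactor n 0) (q lam) :=
    analyticAt_uFactor_zero n hn (by linarith [(hq lam).1, hr, abs_nonneg ((q lam).re)])
  exact AnalyticAt.comp (f := fun p : Fin d → ℂ => p lam) hF (analyticAt_eval lam q)

/-- `R̃_λ` (the `l ≠ 0` part of `φ_λ`, (1.62)) is holomorphic on `F_r` (the shifted denominators do not vanish
there). [cite: Balaban1984PropagatorsI, (1.62) p.28] -/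
theorem analyticAt_Rt (n : ℕ) [NeZero n] {r : ℝ} (hr : r ≤ 1 / 4) (hdr : (d : ℝ) * r ^ 2 ≤ 1 / 16)
    {q : Fin d → ℂ} (hq : q ∈ Fat d r) (lam : Fin d) :
    AnalyticAt ℂ (fun p : Fin d → ℂ => Rt n lam p) q := by
  unfold Rt
  refine Finset.analyticAt_fun_sum _ (fun k hk => ?_)
  have hk0 : k ≠ fun _ => 0 := Finset.ne_of_mem_erase hk
  have hΔ : DeltaXi n 0 (shift n k q) ≠ 0 := by
    intro h
    have := norm_DeltaXi_shift_ge n 0 le_rfl hr hdr hq k hk0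
    rw [h, norm_zero] at this
    linarith
  refine AnalyticAt.fun_div ?_ (analyticAt_DeltaXi_shift n 0 k q) hΔ
  exact (analyticAt_U n hr hq k).fun_mul (analyticAt_uFactor_coord n lam (k lam) hr hq)

/-- `Y_λ = c_λ + ΔR̃_λ` (`= Δφ_λ` of (1.62) at real momenta) is holomorphic on `F_r`. [cite: Balaban1984PropagatorsI, (1.62) p.28] -/
theorem analyticAt_Yc (n : ℕ) [NeZero n] {r : ℝ} (hr : r ≤ 1 / 4) (hdr : (d : ℝ) * r ^ 2 ≤ 1 / 16)
    {q : Fin d → ℂ} (hq : q ∈ Fat d r) (lam : Fin d) :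
    AnalyticAt ℂ (fun p : Fin d → ℂ => Yc n lam p) q := by
  unfold Yc
  exact (analyticAt_cfac n hr hq lam).fun_add
    ((analyticAt_DeltaXi n 0 q).fun_mul (analyticAt_Rt n hr hdr hq lam))

/-- the zero-free denominator `F` of the continued (1.66) integrand is holomorphic on `F_r`.
[cite: Balaban1984PropagatorsI, (1.66) p.29] -/
theorem analyticAt_F66 (n : ℕ) [NeZero n] {r : ℝ} (hr : r ≤ 1 / 4) (hdr : (d : ℝ) * r ^ 2 ≤ 1 / 16)
    {q : Fin d → ℂ} (hq : q ∈ Fat d r) : AnalyticAt ℂ (fun p : Fin d → ℂ => F66 n p) q := by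
  unfold F66
  refine ((analyticAt_U n hr hq _).fun_pow d).fun_add ?_
  refine Finset.analyticAt_fun_sum _ (fun lam _ => ?_)
  refine (AnalyticAt.comp (f := fun p : Fin d → ℂ => p lam) (analyticAt_S1 _) (analyticAt_eval lam q)).fun_mul ?_
  refine Finset.analyticAt_fun_sum _ (fun T _ => ?_)
  refine ((analyticAt_DeltaXi n 0 q).fun_pow _).fun_mul ?_
  exact (Finset.analyticAt_fun_prod T (fun lam' _ => analyticAt_Rt n hr hdr hq lam')).fun_mul
    (Finset.analyticAt_fun_prod _ (fun lam' _ => analyticAt_cfac n hr hq lam'))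

/-- the continued (1.66) integrand `W_{μν} = Π Y / F` is holomorphic at the fat points where `F ≠ 0`.
[cite: Balaban1984PropagatorsI, (1.66) p.29] -/
theorem analyticAt_W166 (n : ℕ) [NeZero n] {r : ℝ} (hr : r ≤ 1 / 4) (hdr : (d : ℝ) * r ^ 2 ≤ 1 / 16)
    {q : Fin d → ℂ} (hq : q ∈ Fat d r) (μ ν : Fin d) (hF : F66 n q ≠ 0) :
    AnalyticAt ℂ (fun p : Fin d → ℂ => W166 n μ ν p) q := by
  unfold W166
  exact AnalyticAt.fun_div (Finset.analyticAt_fun_prod _ (fun lam _ => analyticAt_Yc n hr hdr hq lam))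
    (analyticAt_F66 n hr hdr hq) hF

/-- a real momentum of the closed Brillouin zone is a point of every fat region `F_r`, `r ≥ 0`. [folklore] -/
private theorem ofRealVec_mem_Fat (s : Fin d → ℝ) (hs : ∀ κ, |s κ| ≤ Real.pi) {r : ℝ} (hr : 0 ≤ r) :
    ofRealVec s ∈ Fat d r := fun ν => by
  refine ⟨?_, ?_⟩
  · simp only [ofRealVec, Complex.ofReal_re]; linarith [hs ν]
  · simp only [ofRealVec, Complex.ofReal_im, abs_zero]; linarith

/-- THE CONTINUED (1.66) INTEGRAND IS HOLOMORPHIC AT EVERY REAL MOMENTUM OF THE CLOSED ZONE (every `n ≥ 1`, all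
`μ, ν`): its denominator `F` does not vanish there (`B5Symbol166.F66_ofReal_ne_zero`).
[cite: Balaban1984PropagatorsI, (1.66) p.29] -/
theorem analyticAt_W166_ofReal (n : ℕ) [NeZero n] (μ ν : Fin d) (s : Fin d → ℝ) (hs : ∀ κ, |s κ| ≤ Real.pi) :
    AnalyticAt ℂ (fun p : Fin d → ℂ => W166 n μ ν p) (ofRealVec s) := by
  have hn : 1 ≤ n := Nat.one_le_iff_ne_zero.mpr (NeZero.ne n)
  exact analyticAt_W166 n (r := 0) (by norm_num) (by norm_num) (ofRealVec_mem_Fat s hs le_rfl) μ ν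
    (F66_ofReal_ne_zero n hn s hs)

/-- the entire factor `e^{ip_b} − 1` (continuation of `∂¹_b(p′) = e^{ip′_b} − 1`) is analytic on `ℂ^d`.
[cite: Balaban1984PropagatorsI, (1.31) p.23] -/
theorem analyticAt_expFacPos (b : Fin d) (q : Fin d → ℂ) :
    AnalyticAt ℂ (fun p : Fin d → ℂ => expFacPos b p) q := by
  unfold expFacPos
  exact (analyticAt_cexp.comp ((analyticAt_eval b q).fun_mul analyticAt_const)).fun_sub analyticAt_const

/-- the entire factor `e^{−ip_a} − 1` (continuation of `conj ∂¹_a(p′)`) is analytic on `ℂ^d`.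
[cite: Balaban1984PropagatorsI, (1.31) p.23] -/
theorem analyticAt_expFacNeg (a : Fin d) (q : Fin d → ℂ) :
    AnalyticAt ℂ (fun p : Fin d → ℂ => expFacNeg a p) q := by
  unfold expFacNeg
  exact (analyticAt_cexp.comp ((analyticAt_eval a q).fun_mul analyticAt_const).fun_neg).fun_sub
    analyticAt_const

/-! ## §2. The continued symbol `Δ̃ᶜ_{j,μν}(p)` and its restriction to real momenta -/

/-- THE HOLOMORPHIC CONTINUATION of the entries of `Δ̃_j`: for `μ ≠ ν`,
`Δ̃ᶜ_{j,μν}(p) := −W_{μν}(p)·(e^{−ip_μ} − 1)(e^{ip_ν} − 1)`; for `μ = ν`,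
`Δ̃ᶜ_{j,νν}(p) := Σ_{κ≠ν} W_{κν}(p)·(e^{−ip_κ} − 1)(e^{ip_κ} − 1)` (`W` = `B5Symbol166.W166`, the zero-free normal form
of the (1.66) integrand).  On real momenta this is `Δ̃_{j,μν}(p′)` (`symbC_ofReal`).
[cite: Balaban1987RG1, (4.40)–(4.41) p.291] [folklore] -/
def symbC (n : ℕ) [NeZero n] (μ ν : Fin d) (p : Fin d → ℂ) : ℂ :=
  if μ = ν then ∑ κ ∈ univ.erase ν, W166 n κ ν p * (expFacNeg κ p * expFacPos κ p)
  else -(W166 n μ ν p * (expFacNeg μ p * expFacPos ν p))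

/-- `(e^{−ip′_a} − 1)(e^{ip′_a} − 1) = |∂¹_a(p′)|²` at real momenta. [folklore] -/
private theorem expFacNeg_mul_expFacPos_ofReal (a : Fin d) (s : Fin d → ℝ) :
    expFacNeg a (ofRealVec s) * expFacPos a (ofRealVec s) = ((‖d1Sym s a‖ ^ 2 : ℝ) : ℂ) := by
  rw [expFacNeg_ofReal, expFacPos_ofReal, Complex.conj_mul']
  push_cast; rfl

/-- the typed `Δ̃_j` vanishes at `p′ = 0` (every entry carries a factor `∂¹(0) = 0`).
[cite: Balaban1987RG1, (4.45) p.292] -/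
theorem symbDeltaJ_zero (n : ℕ) (μ ν : Fin d) : symbDeltaJ n (0 : Fin d → ℝ) μ ν = 0 := by
  have h0 : ∀ κ, d1Sym (0 : Fin d → ℝ) κ = 0 := fun κ => by simp [d1Sym]
  simp [symbDeltaJ, symbW, h0]

/-- the continued entries vanish at `p = 0` too (a factor `e^{i0} − 1 = 0`; no junk value of the typed weight
enters). [folklore] -/
private theorem symbC_zero (n : ℕ) [NeZero n] (μ ν : Fin d) : symbC n μ ν (0 : Fin d → ℂ) = 0 := by
  have h0 : ∀ κ, expFacPos κ (0 : Fin d → ℂ) = 0 := fun κ => by simp [expFacPos]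
  unfold symbC
  split_ifs <;> simp [h0]

/-- `ofRealVec 0 = 0`. [folklore] -/
private theorem ofRealVec_zero : ofRealVec (0 : Fin d → ℝ) = 0 := by
  funext μ; simp [ofRealVec]

/-- **the continuation restricts to the typed symbol**: for every real momentum of the closed Brillouin zone
(`|p′_κ| ≤ π`, the point `p′ = 0` INCLUDED) and every `n ≥ 1`, `Δ̃ᶜ_{j,μν}(p′) = Δ̃_{j,μν}(p′)`
(`B5Symbol166.W166_ofReal` for the weights `w_{κν}`, `κ ≠ ν`; the diagonal weight `w_{νν}` cancels in
`Δ̃_{j,νν} = Σ_κ w_{κν}|∂¹_κ|² − w_{νν}|∂¹_ν|²`). [cite: Balaban1987RG1, (4.41) p.291] -/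
theorem symbC_ofReal (n : ℕ) [NeZero n] (μ ν : Fin d) (s : Fin d → ℝ) (hs : ∀ κ, |s κ| ≤ Real.pi) :
    symbC n μ ν (ofRealVec s) = symbDeltaJ n s μ ν := by
  have hn : 1 ≤ n := Nat.one_le_iff_ne_zero.mpr (NeZero.ne n)
  by_cases hs0 : s = 0
  · subst hs0
    rw [ofRealVec_zero, symbC_zero, symbDeltaJ_zero]
  obtain ⟨ν₀, hν₀⟩ : ∃ ν₀, s ν₀ ≠ 0 := by
    by_contra h
    push Not at h
    exact hs0 (funext h)
  have hW : ∀ {κ τ : Fin d}, κ ≠ τ → W166 n κ τ (ofRealVec s) = ((w166 n κ τ s : ℝ) : ℂ) :=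
    fun hκτ => W166_ofReal n hn hκτ s hs ν₀ hν₀
  unfold symbC symbDeltaJ symbW
  by_cases hμν : μ = ν
  · subst hμν
    simp only [if_true]
    set g : Fin d → ℂ := fun κ => ((w166 n κ μ s * ‖d1Sym s κ‖ ^ 2 : ℝ) : ℂ) with hg
    have h1 : ∑ κ ∈ univ.erase μ, W166 n κ μ (ofRealVec s) * (expFacNeg κ (ofRealVec s) * expFacPos κ (ofRealVec s))
        = ∑ κ ∈ univ.erase μ, g κ := Finset.sum_congr rfl fun κ hκ => by
      rw [hW (Finset.ne_of_mem_erase hκ), expFacNeg_mul_expFacPos_ofReal, hg]; push_cast; ring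
    have h2 : ((w166 n μ μ s : ℝ) : ℂ) * (conj (d1Sym s μ) * d1Sym s μ) = g μ := by
      rw [Complex.conj_mul', hg]; push_cast; ring
    rw [h1, h2, Finset.sum_erase_eq_sub (Finset.mem_univ μ)]
    congr 1
    simp only [hg]
    push_cast
    rfl
  · simp only [hμν, if_false, zero_sub]
    rw [hW hμν, expFacNeg_ofReal, expFacPos_ofReal]

/-! ## §3. Analyticity: of the continuation at the real zone, of `p′ ↦ Δ̃_{j,μν}(p′)` on the open zone -/

/-- the continued entries are holomorphic (jointly analytic on `ℂ^d`) at every real momentum of the closed zone,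
every `n ≥ 1`. [cite: Balaban1987RG1, (4.41) p.291] -/
theorem analyticAt_symbC (n : ℕ) [NeZero n] (μ ν : Fin d) (s : Fin d → ℝ) (hs : ∀ κ, |s κ| ≤ Real.pi) :
    AnalyticAt ℂ (symbC n μ ν) (ofRealVec s) := by
  by_cases hμν : μ = ν
  · have e : symbC n μ ν = fun p => ∑ κ ∈ univ.erase ν, W166 n κ ν p * (expFacNeg κ p * expFacPos κ p) := by
      funext p; simp [symbC, hμν]
    rw [e]
    refine Finset.analyticAt_fun_sum _ (fun κ _ => ?_)
    exact (analyticAt_W166_ofReal n κ ν s hs).fun_mul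
      ((analyticAt_expFacNeg κ _).fun_mul (analyticAt_expFacPos κ _))
  · have e : symbC n μ ν = fun p => -(W166 n μ ν p * (expFacNeg μ p * expFacPos ν p)) := by
      funext p; simp [symbC, hμν]
    rw [e]
    exact ((analyticAt_W166_ofReal n μ ν s hs).fun_mul
      ((analyticAt_expFacNeg μ _).fun_mul (analyticAt_expFacPos ν _))).fun_neg

/-- `p′ ↦ (p′_μ)_μ ∈ ℂ^d` (`B4Strip.ofRealVec`) as a continuous `ℝ`-linear map. [folklore] -/
def ofRealL (d : ℕ) : (Fin d → ℝ) →L[ℝ] (Fin d → ℂ) :=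
  ContinuousLinearMap.pi fun μ => Complex.ofRealCLM.comp (ContinuousLinearMap.proj μ)

/-- `ofRealL` is `ofRealVec`. [folklore] -/
@[simp] private theorem ofRealL_apply (s : Fin d → ℝ) : ofRealL d s = ofRealVec s := rfl

/-- the OPEN Brillouin zone `{p′ : |p′_κ| < π ∀κ}`. [folklore] -/
def zone (d : ℕ) : Set (Fin d → ℝ) := {s | ∀ κ, |s κ| < Real.pi}

/-- the open zone is open. [folklore] -/
private theorem isOpen_zone : IsOpen (zone d) := by
  have : zone d = ⋂ κ, {s : Fin d → ℝ | |s κ| < Real.pi} := by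
    ext s; simp [zone, Set.mem_iInter]
  rw [this]
  exact isOpen_iInter_of_finite fun κ =>
    isOpen_lt (continuous_abs.comp (continuous_apply κ)) continuous_const

/-- `0` is in the open zone. [folklore] -/
private theorem zero_mem_zone : (0 : Fin d → ℝ) ∈ zone d := fun κ => by simp [Real.pi_pos]

/-- a ball of radius `≤ π` about `0` (sup norm) lies in the open zone. [folklore] -/
private theorem ball_subset_zone {R : ℝ} (hR : R ≤ Real.pi) : Metric.ball (0 : Fin d → ℝ) R ⊆ zone d := by
  intro y hy κ
  rw [Metric.mem_ball, dist_zero_right] at hy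
  calc |y κ| = ‖y κ‖ := (Real.norm_eq_abs _).symm
    _ ≤ ‖y‖ := norm_le_pi_norm y κ
    _ < Real.pi := lt_of_lt_of_le hy hR

/-- **`Δ̃_{j,μν}` IS REAL-ANALYTIC ON THE OPEN BRILLOUIN ZONE** (in particular at `p′ = 0`), for every `n = L^j ≥ 1`
and all `μ, ν`: it is the restriction of the holomorphic `Δ̃ᶜ_{j,μν}` along the real-linear embedding `ℝ^d → ℂ^d`.
This is the regularity that the literal derivatives of (4.43)/(4.45) presuppose.
[cite: Balaban1987RG1, (4.43) p.291, (4.45) p.292] -/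
theorem analyticAt_symbDeltaJ (n : ℕ) [NeZero n] (μ ν : Fin d) (s₀ : Fin d → ℝ) (hs₀ : s₀ ∈ zone d) :
    AnalyticAt ℝ (fun s : Fin d → ℝ => symbDeltaJ n s μ ν) s₀ := by
  have hC : AnalyticAt ℝ (symbC n μ ν) (ofRealL d s₀) :=
    (analyticAt_symbC n μ ν s₀ (fun κ => (hs₀ κ).le)).restrictScalars
  have h1 : AnalyticAt ℝ (fun s : Fin d → ℝ => symbC n μ ν (ofRealL d s)) s₀ :=
    AnalyticAt.comp (f := ofRealL d) hC ((ofRealL d).analyticAt s₀)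
  refine h1.congr ?_
  filter_upwards [isOpen_zone.mem_nhds hs₀] with s hs
  rw [ofRealL_apply, symbC_ofReal n μ ν s (fun κ => (hs κ).le)]

/-- hence `Δ̃_{j,μν}` is `C^m` at every point of the open zone for every `m` (incl. `∞`, `ω`).
[cite: Balaban1987RG1, (4.43) p.291] -/
theorem contDiffAt_symbDeltaJ (n : ℕ) [NeZero n] (μ ν : Fin d) {m : WithTop ℕ∞} (s₀ : Fin d → ℝ)
    (hs₀ : s₀ ∈ zone d) : ContDiffAt ℝ m (fun s : Fin d → ℝ => symbDeltaJ n s μ ν) s₀ :=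
  (analyticAt_symbDeltaJ n μ ν s₀ hs₀).contDiffAt

/-- … and Fréchet-differentiable there. [cite: Balaban1987RG1, (4.43) p.291] -/
theorem hasFDerivAt_symbDeltaJ (n : ℕ) [NeZero n] (μ ν : Fin d) (s₀ : Fin d → ℝ) (hs₀ : s₀ ∈ zone d) :
    HasFDerivAt (fun s : Fin d → ℝ => symbDeltaJ n s μ ν)
      (fderiv ℝ (fun s : Fin d → ℝ => symbDeltaJ n s μ ν) s₀) s₀ :=
  ((contDiffAt_symbDeltaJ n μ ν (m := 1) s₀ hs₀).differentiableAt (by norm_num)).hasFDerivAt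

/-! ## §4. (4.45) LITERAL: the first derivative of `Δ̃_{j,μν}` at `p′ = 0` vanishes -/

/-- **(4.45), literal Fréchet form**: `DΔ̃_{j,μν}(0) = 0` — from the gen-6 bound `|Δ̃_{j,μν}(p′)| ≤ C(d)‖p′‖²`
(`B12Eq441SymbolExpansion.norm_symbDeltaJ_le`), for every `n = L^j ≥ 1`. [cite: Balaban1987RG1, (4.45) p.292] -/
theorem hasFDerivAt_symbDeltaJ_zero (n : ℕ) [NeZero n] (μ ν : Fin d) :
    HasFDerivAt (fun s : Fin d → ℝ => symbDeltaJ n s μ ν) (0 : (Fin d → ℝ) →L[ℝ] ℂ) 0 := by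
  have hn : 1 ≤ n := Nat.one_le_iff_ne_zero.mpr (NeZero.ne n)
  rw [hasFDerivAt_iff_isLittleO_nhds_zero]
  simp only [zero_add, symbDeltaJ_zero, sub_zero, zero_apply]
  have hbig : (fun h : Fin d → ℝ => symbDeltaJ n h μ ν) =O[𝓝 0] (fun h : Fin d → ℝ => ‖h‖ ^ 2) := by
    rw [isBigO_iff]
    refine ⟨(d : ℝ) + 1 + taylorConst d * Real.pi, ?_⟩
    filter_upwards [isOpen_zone.mem_nhds zero_mem_zone] with h hh
    rw [Real.norm_of_nonneg (by positivity)]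
    exact norm_symbDeltaJ_le n hn h (fun κ => (hh κ).le) μ ν
  exact hbig.trans_isLittleO (isLittleO_norm_pow_id one_lt_two)

/-- **(4.45)**: `fderiv Δ̃_{j,μν} 0 = 0`. [cite: Balaban1987RG1, (4.45) p.292] -/
theorem fderiv_symbDeltaJ_zero (n : ℕ) [NeZero n] (μ ν : Fin d) :
    fderiv ℝ (fun s : Fin d → ℝ => symbDeltaJ n s μ ν) 0 = 0 :=
  (hasFDerivAt_symbDeltaJ_zero n μ ν).fderiv

/-- the coordinate directions `e_κ`. [folklore] -/
def eDir (κ : Fin d) : Fin d → ℝ := Pi.single κ 1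

/-- `(e_κ)_ι = δ_{ικ}`. [folklore] -/
private theorem eDir_apply (κ ι : Fin d) : eDir κ ι = if ι = κ then 1 else 0 := by
  simp [eDir, Pi.single_apply]

/-- `‖e_κ‖ = 1`. [folklore] -/
private theorem norm_eDir (κ : Fin d) : ‖eDir (d := d) κ‖ = 1 := by
  rw [eDir, Pi.norm_single, norm_one]

/-- **(4.45) componentwise, as printed**: `(∂/∂p′_κ)Δ̃_{j,μν}(0) = 0` for every direction `κ` (the partial
derivative = the Fréchet derivative on `e_κ`; the printed factor `1/i` is immaterial). [cite: Balaban1987RG1, (4.45) p.292] -/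
theorem pderiv_symbDeltaJ_zero (n : ℕ) [NeZero n] (μ ν κ : Fin d) :
    fderiv ℝ (fun s : Fin d → ℝ => symbDeltaJ n s μ ν) 0 (eDir κ) = 0 := by
  rw [fderiv_symbDeltaJ_zero]; rfl

/-- (4.45) along the coordinate line: `t ↦ Δ̃_{j,μν}(t e_κ)` has derivative `0` at `t = 0`.
[cite: Balaban1987RG1, (4.45) p.292] -/
theorem hasDerivAt_symbDeltaJ_line_zero (n : ℕ) [NeZero n] (μ ν κ : Fin d) :
    HasDerivAt (fun t : ℝ => symbDeltaJ n (t • eDir κ) μ ν) 0 0 := by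
  have hL : HasFDerivAt (fun t : ℝ => t • eDir (d := d) κ)
      ((ContinuousLinearMap.id ℝ ℝ).smulRight (eDir κ)) 0 :=
    (hasFDerivAt_id (𝕜 := ℝ) (0 : ℝ)).smul_const (eDir κ)
  have h := (hasFDerivAt_symbDeltaJ_zero n μ ν)
  rw [show (0 : Fin d → ℝ) = (0 : ℝ) • eDir κ by simp] at h
  have hc := h.comp (0 : ℝ) hL
  simp only [ContinuousLinearMap.zero_comp] at hc
  simpa [Function.comp_def] using hc.hasDerivAt

/-! ## §5. (4.43) LITERAL: the Hessian of `Δ̃_{j,μν}` at `p′ = 0` -/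

/-- the quadratic Taylor datum of the gen-6 Peano form, `Q_{μν}(w) = |w|²δ_{μν} − w_μw_ν`
(= `B12Marginal444.transverse μ ν` at `w`, `B12Eq441SymbolExpansion.aeval_transverse`). [cite: Balaban1987RG1, (4.41) p.291] -/
def quadQ (μ ν : Fin d) (w : Fin d → ℝ) : ℝ := (if μ = ν then ∑ κ, w κ ^ 2 else 0) - w μ * w ν

/-- `Q` is `2`-homogeneous: `Q(t w) = t² Q(w)`. [folklore] -/
private theorem quadQ_smul (μ ν : Fin d) (t : ℝ) (w : Fin d → ℝ) : quadQ μ ν (t • w) = t ^ 2 * quadQ μ ν w := by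
  unfold quadQ
  simp only [Pi.smul_apply, smul_eq_mul, mul_pow, ← Finset.mul_sum]
  split_ifs <;> ring

/-- a complex number `c` with `t²c = o(t²)` as `t → 0⁺` is zero. [folklore] -/
private theorem eq_zero_of_isLittleO_sq {c : ℂ}
    (h : (fun t : ℝ => ((t ^ 2 : ℝ) : ℂ) * c) =o[𝓝[>] (0 : ℝ)] fun t : ℝ => t ^ 2) : c = 0 := by
  by_contra hc
  have hc' : 0 < ‖c‖ / 2 := by positivity
  have h1 := (isLittleO_iff.mp h) hc'
  have h2 : ∀ᶠ t : ℝ in 𝓝[>] (0 : ℝ), 0 < t := eventually_mem_nhdsWithin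
  obtain ⟨t, ht1, ht2⟩ := (h1.and h2).exists
  have ht2' : 0 < t ^ 2 := by positivity
  rw [norm_mul, Complex.norm_real, Real.norm_of_nonneg ht2'.le] at ht1
  have : ‖c‖ ≤ ‖c‖ / 2 := le_of_mul_le_mul_left (a := t ^ 2) (by linarith [ht1]) ht2'
  linarith [norm_pos_iff.mpr hc]

section Hessian

variable (n : ℕ) [NeZero n] (μ ν : Fin d)

/-- shorthand: the entry `p′ ↦ Δ̃_{j,μν}(p′)` as a real-variable function. [folklore] -/
def entry (n : ℕ) (μ ν : Fin d) : (Fin d → ℝ) → ℂ := fun s => symbDeltaJ n s μ ν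

/-- shorthand: the Hessian `D²Δ̃_{j,μν}(0)` as a bilinear map. [cite: Balaban1987RG1, (4.43) p.291] -/
def hess (n : ℕ) (μ ν : Fin d) : (Fin d → ℝ) →L[ℝ] (Fin d → ℝ) →L[ℝ] ℂ :=
  fderiv ℝ (fderiv ℝ (entry n μ ν)) 0

/-- the first derivative `p′ ↦ DΔ̃_{j,μν}(p′)` is differentiable at `0` with derivative the Hessian
(from `C²` at `0`). [folklore] -/
private theorem hasFDerivAt_fderiv_entry_zero :
    HasFDerivAt (fderiv ℝ (entry n μ ν)) (hess n μ ν) 0 := by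
  have h2 : ContDiffAt ℝ 2 (entry n μ ν) 0 := contDiffAt_symbDeltaJ n μ ν 0 zero_mem_zone
  have h1 : ContDiffAt ℝ 1 (fderiv ℝ (entry n μ ν)) 0 := h2.fderiv_right (m := 1) le_rfl
  exact (h1.differentiableAt (by norm_num)).hasFDerivAt

/-- near `0` the entry is differentiable with derivative `fderiv`. [folklore] -/
private theorem eventually_hasFDerivAt_entry :
    ∀ᶠ y in 𝓝 (0 : Fin d → ℝ), HasFDerivAt (entry n μ ν) (fderiv ℝ (entry n μ ν) y) y := by
  filter_upwards [isOpen_zone.mem_nhds zero_mem_zone] with y hy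
  exact hasFDerivAt_symbDeltaJ n μ ν y hy

/-- **the Hessian of `Δ̃_{j,μν}` at `0` is symmetric** (Schwarz). [cite: Balaban1987RG1, (4.43) p.291] -/
theorem hess_symm (v w : Fin d → ℝ) : hess n μ ν v w = hess n μ ν w v :=
  second_derivative_symmetric_of_eventually (eventually_hasFDerivAt_entry n μ ν)
    (hasFDerivAt_fderiv_entry_zero n μ ν) v w

/-- **(4.43) on rays**: `D²Δ̃_{j,μν}(0)(w, w) = 2·Q_{μν}(w) = 2(|w|²δ_{μν} − w_μw_ν)` for `‖w‖∞ < 3` — the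
second-order Taylor expansion along `h ↦ hw` (`Convex.taylor_approx_two_segment`) compared with the gen-6 Peano
form `Δ̃_{j,μν}(hw) = h²Q_{μν}(w) + O(h³)` (`B12Eq441SymbolExpansion.symbDeltaJ_taylor`), every `n = L^j ≥ 1`.
[cite: Balaban1987RG1, (4.43) p.291] -/
theorem hess_apply_self_of_norm_lt (w : Fin d → ℝ) (hw : ‖w‖ < 3) :
    hess n μ ν w w = 2 * ((quadQ μ ν w : ℝ) : ℂ) := by
  have hn : 1 ≤ n := Nat.one_le_iff_ne_zero.mpr (NeZero.ne n)
  have hπ := Real.pi_gt_three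
  set B := Metric.ball (0 : Fin d → ℝ) 3 with hB
  have hint : interior B = B := Metric.isOpen_ball.interior_eq
  have hBz : B ⊆ zone d := ball_subset_zone (by linarith)
  have hf : ∀ x ∈ interior B, HasFDerivAt (entry n μ ν) (fderiv ℝ (entry n μ ν) x) x := fun x hx =>
    hasFDerivAt_symbDeltaJ n μ ν x (hBz (hint ▸ hx))
  have xs : (0 : Fin d → ℝ) ∈ B := Metric.mem_ball_self (by norm_num)
  have hx : HasFDerivWithinAt (fderiv ℝ (entry n μ ν)) (hess n μ ν) (interior B) 0 :=
    (hasFDerivAt_fderiv_entry_zero n μ ν).hasFDerivWithinAt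
  have hv : (0 : Fin d → ℝ) + 0 ∈ interior B := by rw [add_zero, hint]; exact xs
  have hw' : (0 : Fin d → ℝ) + 0 + w ∈ interior B := by
    rw [add_zero, zero_add, hint, hB, Metric.mem_ball, dist_zero_right]; exact hw
  have T := Convex.taylor_approx_two_segment (convex_ball (0 : Fin d → ℝ) 3) hf xs hx hv hw'
  -- simplify the Taylor expansion: f 0 = 0, f′(0) = 0, D²(0, w) = 0
  have f0 : entry n μ ν 0 = 0 := symbDeltaJ_zero n μ ν
  have f1 : fderiv ℝ (entry n μ ν) 0 = 0 := fderiv_symbDeltaJ_zero n μ ν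
  have T' : (fun h : ℝ => entry n μ ν (h • w) - ((h ^ 2 / 2 : ℝ) : ℂ) * hess n μ ν w w)
      =o[𝓝[>] (0 : ℝ)] fun h : ℝ => h ^ 2 := by
    refine T.congr' (Eventually.of_forall fun h => ?_) EventuallyEq.rfl
    simp only [smul_zero, add_zero, zero_add, f0, f1, zero_apply, sub_zero, map_zero, Complex.real_smul]
  -- the Peano form along the ray
  have P : (fun h : ℝ => entry n μ ν (h • w) - ((h ^ 2 * quadQ μ ν w : ℝ) : ℂ))
      =o[𝓝[>] (0 : ℝ)] fun h : ℝ => h ^ 2 := by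
    have hO : (fun h : ℝ => entry n μ ν (h • w) - ((h ^ 2 * quadQ μ ν w : ℝ) : ℂ))
        =O[𝓝[>] (0 : ℝ)] fun h : ℝ => h ^ 3 := by
      rw [isBigO_iff]
      refine ⟨taylorConst d * ‖w‖ ^ 3, ?_⟩
      have hI : Set.Ioc (0 : ℝ) 1 ∈ 𝓝[>] (0 : ℝ) := Ioc_mem_nhdsGT one_pos
      filter_upwards [hI] with h hh
      have hh0 : 0 ≤ h := hh.1.le
      have hs : ∀ κ, |(h • w) κ| ≤ Real.pi := fun κ => by
        rw [Pi.smul_apply, smul_eq_mul, abs_mul, abs_of_nonneg hh0]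
        have : |w κ| ≤ ‖w‖ := by rw [← Real.norm_eq_abs]; exact norm_le_pi_norm w κ
        nlinarith [abs_nonneg (w κ), hh.2]
      have key := symbDeltaJ_taylor n hn (h • w) hs μ ν
      rw [← quadQ, quadQ_smul] at key
      rw [Real.norm_of_nonneg (pow_nonneg hh0 3)]
      calc ‖entry n μ ν (h • w) - ((h ^ 2 * quadQ μ ν w : ℝ) : ℂ)‖ ≤ taylorConst d * ‖h • w‖ ^ 3 := key
        _ = taylorConst d * ‖w‖ ^ 3 * h ^ 3 := by rw [norm_smul, Real.norm_of_nonneg hh0]; ring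
    have h32 : (fun h : ℝ => h ^ 3) =o[𝓝[>] (0 : ℝ)] fun h : ℝ => h ^ 2 :=
      (isLittleO_pow_pow (by norm_num : 2 < 3)).mono nhdsWithin_le_nhds
    exact hO.trans_isLittleO h32
  -- subtract: `h²(½D²(w,w) − Q(w)) = o(h²)`, hence the bracket vanishes
  have D : (fun t : ℝ => ((t ^ 2 : ℝ) : ℂ) * ((1 / 2 : ℂ) * hess n μ ν w w - ((quadQ μ ν w : ℝ) : ℂ)))
      =o[𝓝[>] (0 : ℝ)] fun t : ℝ => t ^ 2 := by
    refine (P.sub T').congr' (Eventually.of_forall fun h => ?_) EventuallyEq.rfl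
    push_cast; ring
  have h0 := eq_zero_of_isLittleO_sq D
  linear_combination (2 : ℂ) * h0

/-- **(4.43) on all rays**: `D²Δ̃_{j,μν}(0)(w, w) = 2(|w|²δ_{μν} − w_μw_ν)` for EVERY `w ∈ ℝ^d` (both sides are
`2`-homogeneous). [cite: Balaban1987RG1, (4.43) p.291] -/
theorem hess_apply_self (w : Fin d → ℝ) : hess n μ ν w w = 2 * ((quadQ μ ν w : ℝ) : ℂ) := by
  by_cases hw : w = 0
  · subst hw; simp [quadQ]
  · have hnw : 0 < ‖w‖ := norm_pos_iff.mpr hw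
    set t : ℝ := ‖w‖⁻¹ with ht
    have ht0 : 0 < t := inv_pos.mpr hnw
    have htw : ‖t • w‖ < 3 := by
      rw [norm_smul, Real.norm_of_nonneg ht0.le, ht, inv_mul_cancel₀ hnw.ne']; norm_num
    have h := hess_apply_self_of_norm_lt n μ ν (t • w) htw
    simp only [quadQ_smul, map_smul, smul_apply, Complex.real_smul] at h
    push_cast at h
    have htc : ((t : ℂ)) ^ 2 ≠ 0 := pow_ne_zero 2 (by exact_mod_cast ht0.ne')
    exact mul_left_cancel₀ htc (by linear_combination h)

/-- **polarization**: `D²Δ̃_{j,μν}(0)(v, w) = Q_{μν}(v + w) − Q_{μν}(v) − Q_{μν}(w)`. [cite: Balaban1987RG1, (4.43) p.291] -/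
theorem hess_eq_polar (v w : Fin d → ℝ) :
    hess n μ ν v w = ((quadQ μ ν (v + w) - quadQ μ ν v - quadQ μ ν w : ℝ) : ℂ) := by
  have h1 := hess_apply_self n μ ν (v + w)
  have h2 := hess_apply_self n μ ν v
  have h3 := hess_apply_self n μ ν w
  have hs := hess_symm n μ ν v w
  simp only [map_add, add_apply] at h1
  push_cast
  linear_combination (1 / 2 : ℂ) * h1 - (1 / 2 : ℂ) * h2 - (1 / 2 : ℂ) * h3 + (1 / 2 : ℂ) * hs

end Hessian

/-! ### The entries `(∂²/∂p′_κ∂p′_λ)Δ̃_{j,μν}(0)` -/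

/-- Kronecker's `δ_{ab}` (real). [folklore] -/
def kdR (a b : Fin d) : ℝ := if a = b then 1 else 0

/-- `(e_κ)_ι = δ_{ικ}`. [folklore] -/
private theorem eDir_apply_kdR (κ ι : Fin d) : eDir κ ι = kdR ι κ := by
  rw [eDir_apply, kdR]

/-- `Σ_ι (e_κ + e_λ)_ι² = 2 + 2δ_{κλ}`. [folklore] -/
private theorem sum_sq_eDir_add (κ l : Fin d) : ∑ ι, (eDir κ + eDir l) ι ^ 2 = 2 + 2 * kdR κ l := by
  by_cases hκl : κ = l
  · subst hκl
    have hpt : ∀ ι, (eDir κ + eDir κ) ι ^ 2 = if ι = κ then 4 else 0 := fun ι => by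
      rw [Pi.add_apply, eDir_apply]; split_ifs <;> norm_num
    simp only [hpt, Finset.sum_ite_eq', Finset.mem_univ, if_true, kdR]
    norm_num
  · have hpt : ∀ ι, (eDir κ + eDir l) ι ^ 2 = (if ι = κ then 1 else 0) + (if ι = l then 1 else 0) := fun ι => by
      rw [Pi.add_apply, eDir_apply, eDir_apply]
      by_cases h1 : ι = κ
      · subst h1; simp [hκl]
      · by_cases h2 : ι = l
        · subst h2; simp [h1]
        · simp [h1, h2]
    simp only [hpt, Finset.sum_add_distrib, Finset.sum_ite_eq', Finset.mem_univ, if_true, kdR, hκl, if_false]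
    norm_num

/-- `Σ_ι (e_κ)_ι² = 1`. [folklore] -/
private theorem sum_sq_eDir (κ : Fin d) : ∑ ι, (eDir (d := d) κ) ι ^ 2 = 1 := by
  have hpt : ∀ ι, (eDir (d := d) κ) ι ^ 2 = if ι = κ then 1 else 0 := fun ι => by
    rw [eDir_apply]; split_ifs <;> norm_num
  simp only [hpt, Finset.sum_ite_eq', Finset.mem_univ, if_true]

/-- the polarized quadratic datum on coordinate directions is minus the tensor of (4.43):
`Q_{μν}(e_κ + e_λ) − Q_{μν}(e_κ) − Q_{μν}(e_λ) = −(δ_{μκ}δ_{νλ} + δ_{μλ}δ_{νκ} − 2δ_{μν}δ_{κλ})`. [folklore] -/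
private theorem quadQ_polar_eDir (μ ν κ l : Fin d) :
    quadQ μ ν (eDir κ + eDir l) - quadQ μ ν (eDir κ) - quadQ μ ν (eDir l)
      = -(kdR μ κ * kdR ν l + kdR μ l * kdR ν κ - 2 * (kdR μ ν * kdR κ l)) := by
  have hite : ∀ X : ℝ, (if μ = ν then X else 0) = kdR μ ν * X := fun X => by
    unfold kdR; split_ifs <;> ring
  simp only [quadQ, hite, sum_sq_eDir_add, sum_sq_eDir]
  simp only [Pi.add_apply, eDir_apply_kdR]
  ring

/-- **(4.43), LITERAL — the mixed second derivatives of Bałaban's symbol at `p′ = 0`**: for every `n = L^j ≥ 1`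
and all `μ ν κ λ`, `(∂²/∂p′_κ∂p′_λ)Δ̃_{j,μν}(0) := D²Δ̃_{j,μν}(0)(e_κ, e_λ) = −(δ_{μκ}δ_{νλ} + δ_{μλ}δ_{νκ} − 2δ_{μν}δ_{κλ})`
(no dependence on `j`). [cite: Balaban1987RG1, (4.43) p.291] -/
theorem hess_eDir (n : ℕ) [NeZero n] (μ ν κ l : Fin d) :
    hess n μ ν (eDir κ) (eDir l)
      = -((kdR μ κ * kdR ν l + kdR μ l * kdR ν κ - 2 * (kdR μ ν * kdR κ l) : ℝ) : ℂ) := by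
  rw [hess_eq_polar, quadQ_polar_eDir]; push_cast; ring

/-- **(4.43) AS PRINTED**: `−((∂²/∂p′_κ∂p′_λ)Δ̃_{j,μν})(0) = δ_{μκ}δ_{νλ} + δ_{μλ}δ_{νκ} − 2δ_{μν}δ_{κλ}` — the second
«=» of the display, for the typed `Δ_j` of [10] (1.66), uniformly in `j`; with the tree's Kronecker symbol
`B12Marginal444.kd` of the (4.43) ⇒ (4.44) algebra (`block2_of_moments443`). [cite: Balaban1987RG1, (4.43) p.291] -/
theorem neg_hess_eDir (n : ℕ) [NeZero n] (μ ν κ l : Fin d) :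
    -hess n μ ν (eDir κ) (eDir l)
      = ((B12Marginal444.kd μ κ * B12Marginal444.kd ν l + B12Marginal444.kd μ l * B12Marginal444.kd ν κ
          - 2 * B12Marginal444.kd μ ν * B12Marginal444.kd κ l : ℚ) : ℂ) := by
  have hk : ∀ a b : Fin d, ((B12Marginal444.kd a b : ℚ) : ℂ) = ((kdR a b : ℝ) : ℂ) := fun a b => by
    unfold B12Marginal444.kd kdR; split_ifs <;> simp
  rw [hess_eDir]
  push_cast
  simp only [hk]
  ring

/-- (4.43) in `iteratedFDeriv` form: the second Fréchet derivative of `p′ ↦ Δ̃_{j,μν}(p′)` at `0` on `(e_κ, e_λ)`.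
[cite: Balaban1987RG1, (4.43) p.291] -/
theorem iteratedFDeriv_two_symbDeltaJ_eDir (n : ℕ) [NeZero n] (μ ν κ l : Fin d) :
    iteratedFDeriv ℝ 2 (fun s : Fin d → ℝ => symbDeltaJ n s μ ν) 0 ![eDir κ, eDir l]
      = -((kdR μ κ * kdR ν l + kdR μ l * kdR ν κ - 2 * (kdR μ ν * kdR κ l) : ℝ) : ℂ) := by
  rw [iteratedFDeriv_two_apply, ← hess_eDir n μ ν κ l]
  rfl

/-- (4.43) as an iterated PARTIAL derivative along coordinate lines: with `∂_λΔ̃_{j,μν}(p′) := DΔ̃_{j,μν}(p′)(e_λ)`,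
the function `t ↦ ∂_λΔ̃_{j,μν}(t e_κ)` has derivative `−(δ_{μκ}δ_{νλ} + δ_{μλ}δ_{νκ} − 2δ_{μν}δ_{κλ})` at `t = 0`.
[cite: Balaban1987RG1, (4.43) p.291] -/
theorem hasDerivAt_pderiv_symbDeltaJ_line_zero (n : ℕ) [NeZero n] (μ ν κ l : Fin d) :
    HasDerivAt (fun t : ℝ => fderiv ℝ (fun s : Fin d → ℝ => symbDeltaJ n s μ ν) (t • eDir κ) (eDir l))
      (-((kdR μ κ * kdR ν l + kdR μ l * kdR ν κ - 2 * (kdR μ ν * kdR κ l) : ℝ) : ℂ)) 0 := by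
  have hL : HasDerivAt (fun t : ℝ => t • eDir (d := d) κ) (eDir κ) 0 := by
    simpa using (hasDerivAt_id (0 : ℝ)).smul_const (eDir (d := d) κ)
  have hF : HasFDerivAt (fderiv ℝ (entry n μ ν)) (hess n μ ν) ((fun t : ℝ => t • eDir (d := d) κ) 0) := by
    simpa using hasFDerivAt_fderiv_entry_zero n μ ν
  have hc : HasDerivAt (fun t : ℝ => fderiv ℝ (entry n μ ν) (t • eDir κ)) (hess n μ ν (eDir κ)) 0 :=
    hF.comp_hasDerivAt (0 : ℝ) hL
  have hev := hc.clm_apply (hasDerivAt_const (0 : ℝ) (eDir (d := d) l))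
  simp only [zero_smul, map_zero, add_zero] at hev
  rw [← hess_eDir n μ ν κ l]
  exact hev

/-- the same with `B12Marginal444.transverse`: `D²Δ̃_{j,μν}(0)(e_κ,e_λ)` is the `(κ,λ)` second partial derivative of the
transverse polynomial `δ_{μν}Σ_ρX_ρ² − X_μX_ν` (a constant polynomial; `B12Marginal444.neg_hessian_transverse`), i.e.
the Peano datum of `B12Eq441SymbolExpansion.symbDeltaJ_sub_aeval_transverse_le` IS the literal Hessian.
[cite: Balaban1987RG1, (4.43) p.291] -/
theorem hess_eDir_eq_pderiv_transverse (n : ℕ) [NeZero n] (μ ν κ l : Fin d) (x : Fin d → ℚ) :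
    hess n μ ν (eDir κ) (eDir l)
      = ((MvPolynomial.eval x (MvPolynomial.pderiv κ (MvPolynomial.pderiv l (B12Marginal444.transverse μ ν))) : ℚ)
          : ℂ) := by
  have h := B12Marginal444.neg_hessian_transverse μ ν κ l
  rw [neg_eq_iff_eq_neg] at h
  rw [h, map_neg, MvPolynomial.eval_C, Rat.cast_neg, ← neg_hess_eDir n μ ν κ l, neg_neg]


end Literature.MathematicalPhysics.QuantumFieldTheory.Balaban1983to89.B12Eq443SymbolHessian
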